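import Literature.NumberTheory.Transcendental.BakerQuantSetup
import Literature.NumberTheory.Transcendental.BakerQuantArith
import Literature.NumberTheory.Transcendental.BakerLinearFormsQuantitative
import Mathlib.Algebra.Polynomial.Reverse
import Mathlib.Analysis.SpecialFunctions.Pow.Real
import HarnessLib

/-!
# Baker 1975, Ch. 3 — reduction of Theorem 3.1 to the normal form `(1)`

Support for the proof of Theorem 3.1 of A. Baker, *Transcendental Number Theory* (1975), Ch. 3
(`Literature.NumberTheory.Transcendental.baker1975_thm_3_1`). Baker (§3, p. 32) proves the
theorem in the NORMAL FORM: fixed non-zero logarithms `l₁, …, l_{n+1}` of algebraic numbers, and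
algebraic `β₀, β₁, …, βₙ` in a number field with controlled denominators and conjugates, such
that `Λ' = β₀ + β₁ l₁ + ⋯ + βₙ lₙ - l_{n+1}` is very small — "(1) … for some sufficiently large `C`"
— and shows this is impossible unless `Λ' = 0`; the reduction of the theorem as enunciated to (1) is
on p. 37 ("we shall assume that in fact `βₙ ≠ 0` … (1) holds with `βⱼ` replaced by
`β'ⱼ = -βⱼ/βₙ` … the `β'ⱼ` have degrees at most `d²` and heights at most `B' ≤ B^c`") together with
the preliminary observations of §2 (p. 29) on heights of products and quotients.

This file performs that reduction for the tree's rendering of the statement (witness polynomials,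
`BakerLinearFormsQuantitative.lean`) and of the normal form (`Baker1975.Ch3.Setup` / `Data`,
`BakerQuantSetup.lean`), ONCE AND FOR ALL and independently of how the normal form is refuted:

* `baker1975_thm_3_1_of_core` — if for every `Setup S` there is a constant `Cm S` such that every
  `D : Data S` with `|Λ'| ≤ e^{-Cm(S) h}` has `Λ' = 0`, then `baker1975_thm_3_1` holds.

Ingredients (all proved): `inv_norm_le_of_root` (a non-zero root `z` of a non-zero integer
polynomial of height `≤ H` has `|z| ≥ (H+1)⁻¹`, Cauchy's bound for the reversed polynomial);
`quotientData` (denominator `≤ (2B)^{5D₀+2}` and conjugates `≤ (2B)^{5D₀+2}` for `-x/y` from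
witnesses of height `≤ B` for `x, y`, via `Baker1975.Ch3.exists_den_inv`); the coefficient field
`ℚ(α, β)` of degree `≤ d^{2n+1}` (`Baker1975.Ch3.finrank_adjoin_le_prod_natDegree`); the size
parameter `h = (5D₀+2)(log₂ B + 2)` with `2 ≤ h`, `(2B)^{5D₀+2} ≤ eʰ`, `h ≤ 22(D₀+1) log B`; and the
re-indexing putting a logarithm with non-zero coefficient last and discarding zero logarithms.

## References

* A. Baker, *Transcendental Number Theory*, CUP 1975, Ch. 3 §2 (p. 29), §3 eq. (1) (p. 32),
  §4 (p. 37). [BakerTNT1975]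
-/

noncomputable section

open Complex Finset Polynomial

namespace Literature.NumberTheory.Transcendental.Baker1975.Ch3

/-! ### A non-zero root of an integer polynomial is not too small -/

/-- **`|z| ≥ (H+1)⁻¹`** for a non-zero complex root `z` of a non-zero `Q ∈ ℤ[X]` of height `≤ H`:
write `Q = X^v Q₁` with `Q₁(0) ≠ 0`; then `z⁻¹` is a root of the reversed polynomial of `Q₁`, of
height `≤ H`, and Cauchy's bound gives `|z⁻¹| ≤ H + 1`. (The case `n = 0` of Theorem 3.1.)
[cite: BakerTNT1975, Ch. 3 §2 (p. 29)] -/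
theorem inv_norm_le_of_root {Q : ℤ[X]} (hQ : Q ≠ 0) {H : ℝ} (hH : ∀ i, |(Q.coeff i : ℝ)| ≤ H)
    {z : ℂ} (hz0 : z ≠ 0) (hz : aeval z Q = 0) : (H + 1)⁻¹ ≤ ‖z‖ := by
  have hH0 : 0 ≤ H := (abs_nonneg _).trans (hH 0)
  -- remove the powers of `X`
  obtain ⟨Q₁, hQ₁, hndvd⟩ := Q.exists_eq_pow_rootMultiplicity_mul_and_not_dvd hQ 0
  simp only [map_zero, sub_zero] at hQ₁ hndvd
  set v := Q.rootMultiplicity 0 with hv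
  have hQ₁0 : Q₁ ≠ 0 := by rintro rfl; exact hQ (by rw [hQ₁, mul_zero])
  have hcoeff : ∀ i, Q₁.coeff i = Q.coeff (i + v) := fun i => by
    rw [hQ₁, Polynomial.coeff_X_pow_mul]
  have hH₁ : ∀ i, |(Q₁.coeff i : ℝ)| ≤ H := fun i => by rw [hcoeff]; exact hH _
  have hz₁ : aeval z Q₁ = 0 := by
    have : aeval z Q = z ^ v * aeval z Q₁ := by rw [hQ₁, map_mul, map_pow, aeval_X]
    rw [hz] at this
    exact (mul_eq_zero.mp this.symm).resolve_left (pow_ne_zero _ hz0)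
  -- the reversed polynomial has the root `z⁻¹`
  letI : Invertible z := invertibleOfNonzero hz0
  have hrev : aeval z⁻¹ Q₁.reverse = 0 := by
    have h := (Polynomial.eval₂_reverse_eq_zero_iff (algebraMap ℤ ℂ) z Q₁).mpr (by rwa [aeval_def] at hz₁)
    rwa [invOf_eq_inv, ← aeval_def] at h
  have hrev0 : Q₁.reverse ≠ 0 := fun h => hQ₁0 (Polynomial.reverse_eq_zero.mp h)
  have hHrev : ∀ i, |(Q₁.reverse.coeff i : ℝ)| ≤ H := fun i => by
    rw [Polynomial.coeff_reverse]; exact hH₁ _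
  have hle := norm_le_of_aeval_eq_zero hrev0 hHrev hrev
  rw [norm_inv] at hle
  have hzpos : 0 < ‖z‖ := norm_pos_iff.mpr hz0
  rw [inv_le_comm₀ (by linarith) hzpos]
  exact hle

/-! ### Roots and conjugates inside a subfield of `ℂ` -/

section Field

variable {K : IntermediateField ℚ ℂ}

/-- A witness relation `Q(x) = 0` in `ℂ` holds in `K`. [folklore] -/
theorem aeval_coe_eq_zero_iff (x : K) (Q : ℤ[X]) : aeval (x : ℂ) Q = 0 ↔ aeval x Q = 0 := by
  have h : aeval (x : ℂ) Q = ((aeval x Q : K) : ℂ) := by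
    have := Polynomial.aeval_algHom_apply ((IntermediateField.val K).restrictScalars ℤ) x Q
    simpa using this
  rw [h]
  exact_mod_cast Iff.rfl

/-- Conjugates of a root are roots: `Q(φ x) = 0`. [folklore] -/
theorem aeval_emb_eq_zero (φ : K →+* ℂ) {x : K} {Q : ℤ[X]} (hx : aeval x Q = 0) : aeval (φ x) Q = 0 := by
  have := Polynomial.aeval_algHom_apply φ.toIntAlgHom x Q
  rw [RingHom.toIntAlgHom_apply] at this
  rw [this, hx, map_zero]

/-- **Conjugate bound from a witness**: if `Q(x) = 0`, `Q ≠ 0` of height `≤ H`, then every conjugate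
of `x` has absolute value `≤ H + 1`. [cite: BakerTNT1975, Ch. 3 §2 (p. 29)] -/
theorem norm_emb_le_of_root (φ : K →+* ℂ) {x : K} {Q : ℤ[X]} (hQ : Q ≠ 0) {H : ℝ}
    (hH : ∀ i, |(Q.coeff i : ℝ)| ≤ H) (hx : aeval x Q = 0) : ‖φ x‖ ≤ H + 1 :=
  norm_le_of_aeval_eq_zero hQ hH (aeval_emb_eq_zero φ hx)

/-- **A denominator from a witness**: `|lc(Q)| · x` is an algebraic integer. [folklore] -/
theorem isIntegral_natAbs_leadingCoeff_mul {x : K} {Q : ℤ[X]} (hx : aeval x Q = 0) :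
    IsIntegral ℤ (((Q.leadingCoeff.natAbs : ℕ) : K) * x) := by
  have h := isIntegral_leadingCoeff_smul (R := ℤ) (S := K) (p := Q) (x := x) hx
  rw [Algebra.smul_def, algebraMap_int_eq, eq_intCast] at h
  rcases Int.natAbs_eq Q.leadingCoeff with he | he
  · have : ((Q.leadingCoeff.natAbs : ℕ) : K) = (Q.leadingCoeff : K) := by
      rw [he]; simp
    rw [this]; exact h
  · have : ((Q.leadingCoeff.natAbs : ℕ) : K) = -(Q.leadingCoeff : K) := by
      conv_rhs => rw [he]
      simp
    rw [this, neg_mul]; exact h.neg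

variable [FiniteDimensional ℚ K]

/-- `K` is a number field. [folklore] -/
instance : NumberField K :=
  { to_charZero := charZero_of_injective_algebraMap (algebraMap ℚ K).injective
    to_finiteDimensional := inferInstance }

/-- **Heights of a quotient** (Baker 1975, p. 37: "`β'ⱼ = -βⱼ/βₙ` … have degrees at most `d²` and
heights at most `B' ≤ B^c`", here through the field `K ⊇ ℚ(x, y)` of degree `≤ D₀`): if `x, y ∈ K`
are roots of non-zero integer polynomials of height `≤ B` (`B ≥ 2`) and `y ≠ 0`, then `-x/y` has a
denominator `b ≤ (2B)^{5D₀+2}` and all its conjugates are `≤ (2B)^{5D₀+2}`.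
[cite: BakerTNT1975, Ch. 3 §4 (p. 37)] -/
theorem quotientData {D₀ : ℕ} (hK : Module.finrank ℚ K ≤ D₀) {B : ℕ} (hB : 2 ≤ B) {x y : K}
    {Qx Qy : ℤ[X]} (hQx : Qx ≠ 0) (hQy : Qy ≠ 0) (hHx : ∀ i, |(Qx.coeff i : ℝ)| ≤ B)
    (hHy : ∀ i, |(Qy.coeff i : ℝ)| ≤ B) (hx : aeval x Qx = 0) (hy : aeval y Qy = 0) (hy0 : y ≠ 0) :
    ∃ b : ℕ, 1 ≤ b ∧ (b : ℝ) ≤ (2 * B : ℝ) ^ (5 * D₀ + 2) ∧ IsIntegral ℤ ((b : K) * (-x / y)) ∧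
      ∀ φ : K →+* ℂ, ‖φ (-x / y)‖ ≤ (2 * B : ℝ) ^ (5 * D₀ + 2) := by
  set Dk := Module.finrank ℚ K with hDk
  have hDk1 : 1 ≤ Dk := Module.finrank_pos
  have hB1 : (1 : ℝ) ≤ B := by exact_mod_cast (by omega : 1 ≤ B)
  have hB2 : (2 : ℝ) ≤ B := by exact_mod_cast hB
  -- the integer `a_y y`, its conjugates
  set ay : ℕ := Qy.leadingCoeff.natAbs with hay
  have hay1 : 1 ≤ ay := Int.natAbs_pos.mpr (leadingCoeff_ne_zero.mpr hQy)
  have hayB : (ay : ℝ) ≤ B := by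
    have := hHy Qy.natDegree
    rw [coeff_natDegree] at this
    have h' : ((Qy.leadingCoeff.natAbs : ℕ) : ℝ) = |(Qy.leadingCoeff : ℝ)| := by
      rw [Nat.cast_natAbs, Int.cast_abs]
    rw [hay, h']; exact this
  have hint_y : IsIntegral ℤ ((ay : K) * y) := isIntegral_natAbs_leadingCoeff_mul hy
  set M : ℝ := B * (B + 1) with hM
  have hM1 : 1 ≤ M := by rw [hM]; nlinarith
  have hMB : M ≤ 2 * (B : ℝ) ^ 2 := by rw [hM]; nlinarith
  have hconj_y : ∀ φ : K →+* ℂ, ‖φ ((ay : K) * y)‖ ≤ M := fun φ => by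
    rw [map_mul, map_natCast, norm_mul, Complex.norm_natCast, hM]
    exact mul_le_mul hayB (norm_emb_le_of_root φ hQy hHy hy) (norm_nonneg _) (by positivity)
  have hy0' : (ay : K) * y ≠ 0 := mul_ne_zero (by exact_mod_cast (by omega : ay ≠ 0)) hy0
  obtain ⟨c, hc0, hcle, hcint, hcconj⟩ := exists_den_inv hy0' hint_y hM1 hconj_y
  -- the integer `a_x x`
  set ax : ℕ := Qx.leadingCoeff.natAbs with hax
  have hax1 : 1 ≤ ax := Int.natAbs_pos.mpr (leadingCoeff_ne_zero.mpr hQx)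
  have haxB : (ax : ℝ) ≤ B := by
    have := hHx Qx.natDegree
    rw [coeff_natDegree] at this
    have h' : ((Qx.leadingCoeff.natAbs : ℕ) : ℝ) = |(Qx.leadingCoeff : ℝ)| := by
      rw [Nat.cast_natAbs, Int.cast_abs]
    rw [hax, h']; exact this
  have hint_x : IsIntegral ℤ ((ax : K) * x) := isIntegral_natAbs_leadingCoeff_mul hx
  -- common size scale `T = 2B ≥ 4`
  set T : ℝ := 2 * B with hT
  have hT1 : (1 : ℝ) ≤ T := by rw [hT]; linarith
  have hBT : (B : ℝ) ≤ T := by rw [hT]; linarith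
  have hB1T : (B : ℝ) + 1 ≤ T := by rw [hT]; linarith
  have h2M : 2 * M ≤ T ^ 2 := by rw [hT]; nlinarith
  have hMT : M ≤ T ^ 2 := by nlinarith
  have hD₀T : (D₀ : ℝ) ≤ T ^ D₀ := by
    have h1 : (D₀ : ℝ) ≤ 2 ^ D₀ := by exact_mod_cast (Nat.lt_two_pow_self).le
    exact h1.trans (pow_le_pow_left₀ (by norm_num) (by rw [hT]; linarith) D₀)
  have hDkR : (Dk : ℝ) ≤ D₀ := by exact_mod_cast hK
  -- `|c|` as a natural number and as an element of `K`
  have hcR : ((c.natAbs : ℕ) : ℝ) ≤ (2 * M) ^ Dk := by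
    rw [Nat.cast_natAbs, Int.cast_abs]; exact hcle
  have hcn : ((c.natAbs : ℕ) : K) = (c : K) ∨ ((c.natAbs : ℕ) : K) = -(c : K) := by
    rcases Int.natAbs_eq c with he | he
    · left
      have : (c : K) = (((c.natAbs : ℕ) : ℤ) : K) := congrArg (Int.cast : ℤ → K) he
      rw [this, Int.cast_natCast]
    · right
      have : (c : K) = ((-((c.natAbs : ℕ) : ℤ) : ℤ) : K) := congrArg (Int.cast : ℤ → K) he
      rw [this, Int.cast_neg, Int.cast_natCast, neg_neg]
  have hcint' : IsIntegral ℤ (((c.natAbs : ℕ) : K) * ((ay : K) * y)⁻¹) := by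
    rcases hcn with he | he
    · rw [he]; exact hcint
    · rw [he, neg_mul]; exact hcint.neg
  -- `-x/y = -(a_x x)·(|c| (a_y y)⁻¹)·a_y / (a_x |c|)`
  have hayK : (ay : K) ≠ 0 := by exact_mod_cast (by omega : ay ≠ 0)
  have hkey : ((ax * c.natAbs : ℕ) : K) * (-x / y) =
      -(((ax : K) * x) * (((c.natAbs : ℕ) : K) * ((ay : K) * y)⁻¹) * (ay : K)) := by
    rw [Nat.cast_mul]
    field_simp
  refine ⟨ax * c.natAbs, Nat.mul_pos hax1 (Int.natAbs_pos.mpr hc0), ?_, ?_, fun φ => ?_⟩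
  · -- `a_x |c| ≤ B (2M)^{Dk} ≤ T · (T²)^{D₀} ≤ T^{5D₀+2}`
    calc ((ax * c.natAbs : ℕ) : ℝ) = (ax : ℝ) * (c.natAbs : ℕ) := by push_cast; ring
      _ ≤ T * (T ^ 2) ^ D₀ := by
          refine mul_le_mul (haxB.trans hBT) (hcR.trans ?_) (Nat.cast_nonneg _) (by positivity)
          exact (pow_le_pow_right₀ (by linarith) hK).trans (pow_le_pow_left₀ (by positivity) h2M D₀)
      _ = T ^ (2 * D₀ + 1) := by ring
      _ ≤ T ^ (5 * D₀ + 2) := pow_le_pow_right₀ hT1 (by omega)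
  · rw [hkey]
    refine IsIntegral.neg (IsIntegral.mul (hint_x.mul hcint') ?_)
    exact_mod_cast isIntegral_algebraMap (R := ℤ) (A := K) (x := (ay : ℤ))
  · -- conjugates: `‖φ(-x/y)‖ = ‖φ x‖ · a_y · ‖φ (a_y y)⁻¹‖`
    have hyinv : -x / y = -(x * ((ay : K) * ((ay : K) * y)⁻¹)) := by
      field_simp
    rw [hyinv, map_neg, norm_neg, map_mul, map_mul, map_natCast, norm_mul, norm_mul, Complex.norm_natCast]
    have h1 := norm_emb_le_of_root φ hQx hHx hx
    have h2 := hcconj φ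
    have h3 : (Dk : ℝ) * (2 * M) ^ Dk * M ^ Dk ≤ T ^ D₀ * (T ^ 2) ^ D₀ * (T ^ 2) ^ D₀ := by
      have e1 : (2 * M) ^ Dk ≤ (T ^ 2) ^ D₀ :=
        (pow_le_pow_right₀ (by linarith) hK).trans (pow_le_pow_left₀ (by positivity) h2M D₀)
      have e2 : M ^ Dk ≤ (T ^ 2) ^ D₀ :=
        (pow_le_pow_right₀ hM1 hK).trans (pow_le_pow_left₀ (by positivity) hMT D₀)
      exact mul_le_mul (mul_le_mul (hDkR.trans hD₀T) e1 (by positivity) (by positivity)) e2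
        (by positivity) (by positivity)
    calc ‖φ x‖ * ((ay : ℝ) * ‖φ ((ay : K) * y)⁻¹‖)
        ≤ T * (T * (T ^ D₀ * (T ^ 2) ^ D₀ * (T ^ 2) ^ D₀)) :=
          mul_le_mul (h1.trans hB1T) (mul_le_mul (hayB.trans hBT) (h2.trans h3) (norm_nonneg _)
            (by positivity)) (by positivity) (by positivity)
      _ = T ^ (5 * D₀ + 2) := by ring

end Field

/-! ### The size parameter `h` -/

/-- **The size parameter** `h = (5D₀+2)(log₂ B + 2)` (Baker's `h = [log(kB)]`, here with the
constant absorbed: `eʰ` dominates the denominators and conjugates `(2B)^{5D₀+2}` of the normalised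
coefficients, and `h ≤ 22(D₀+1) log B`). [cite: BakerTNT1975, Ch. 3 §3 (p. 32)] -/
def hOf (D₀ B : ℕ) : ℕ := (5 * D₀ + 2) * (Nat.log 2 B + 2)

/-- `2 ≤ h`. [folklore] -/
theorem two_le_hOf (D₀ B : ℕ) : 2 ≤ hOf D₀ B := by
  unfold hOf; nlinarith [Nat.zero_le D₀, Nat.zero_le (Nat.log 2 B)]

/-- **`(2B)^{5D₀+2} ≤ eʰ`.** [folklore] -/
theorem pow_le_exp_hOf (D₀ : ℕ) {B : ℕ} (hB : 2 ≤ B) : (2 * B : ℝ) ^ (5 * D₀ + 2) ≤ Real.exp (hOf D₀ B) := by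
  -- `2B ≤ 2^{log₂ B + 2}`
  have h1 : 2 * B ≤ 2 ^ (Nat.log 2 B + 2) := by
    have := Nat.lt_pow_succ_log_self (b := 2) (by norm_num) B
    rw [pow_succ]; omega
  have h1R : (2 * B : ℝ) ≤ (2 : ℝ) ^ (Nat.log 2 B + 2) := by exact_mod_cast h1
  calc (2 * B : ℝ) ^ (5 * D₀ + 2) ≤ ((2 : ℝ) ^ (Nat.log 2 B + 2)) ^ (5 * D₀ + 2) :=
        pow_le_pow_left₀ (by positivity) h1R _
    _ = (2 : ℝ) ^ hOf D₀ B := by rw [← pow_mul, hOf, mul_comm]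
    _ ≤ Real.exp 1 ^ hOf D₀ B := by
        refine pow_le_pow_left₀ (by norm_num) ?_ _
        have := Real.add_one_le_exp (1 : ℝ)
        norm_num at this ⊢; linarith
    _ = Real.exp (hOf D₀ B) := by rw [← Real.exp_nat_mul, mul_one]

/-- **`h ≤ 22 (D₀+1) log B`** for `B ≥ 2`. [folklore] -/
theorem hOf_le (D₀ : ℕ) {B : ℕ} (hB : 2 ≤ B) : (hOf D₀ B : ℝ) ≤ 22 * (D₀ + 1) * Real.log B := by
  have hB2 : (2 : ℝ) ≤ B := by exact_mod_cast hB
  have hlog2 : Real.log 2 ≤ Real.log B := Real.log_le_log two_pos hB2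
  have hl2 : (0.69 : ℝ) < Real.log 2 := by
    have := Real.log_two_gt_d9; linarith
  -- `log₂ B · log 2 ≤ log B`
  have hnat : (Nat.log 2 B : ℝ) * Real.log 2 ≤ Real.log B := by
    have h1 : ((2 ^ Nat.log 2 B : ℕ) : ℝ) ≤ B := by exact_mod_cast Nat.pow_log_le_self 2 (by omega)
    have h2 := Real.log_le_log (by positivity) h1
    rw [Nat.cast_pow, Nat.cast_ofNat, Real.log_pow] at h2
    exact h2
  have hnat' : (Nat.log 2 B : ℝ) ≤ Real.log B / Real.log 2 := by
    rw [le_div_iff₀ (by linarith)]; exact hnat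
  have h3 : (Nat.log 2 B : ℝ) + 2 ≤ 3 * Real.log B / Real.log 2 := by
    have : (2 : ℝ) ≤ 2 * Real.log B / Real.log 2 := by
      rw [le_div_iff₀ (by linarith)]; linarith
    calc (Nat.log 2 B : ℝ) + 2 ≤ Real.log B / Real.log 2 + 2 * Real.log B / Real.log 2 := by linarith
      _ = 3 * Real.log B / Real.log 2 := by ring
  have h4 : 3 * Real.log B / Real.log 2 ≤ 4.4 * Real.log B := by
    rw [div_le_iff₀ (by linarith)]
    have : 0 ≤ Real.log B := le_trans (by linarith) hlog2
    nlinarith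
  unfold hOf
  push_cast
  have h5 : (5 * (D₀ : ℝ) + 2) ≤ 5 * (D₀ + 1) := by linarith
  have h6 : (0 : ℝ) ≤ (Nat.log 2 B : ℝ) + 2 := by positivity
  calc (5 * (D₀ : ℝ) + 2) * ((Nat.log 2 B : ℝ) + 2) ≤ (5 * (D₀ + 1)) * (4.4 * Real.log B) :=
        mul_le_mul h5 (h3.trans h4) h6 (by positivity)
    _ = 22 * (D₀ + 1) * Real.log B := by ring

/-! ### The coefficient field `ℚ(α, β)` -/

section CoeffField

variable {n d : ℕ} (α : Fin n → ℂ) (β : Fin (n + 1) → ℂ)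

/-- The coefficient field `K = ℚ(α₁, …, αₙ, β₀, …, βₙ) ⊆ ℂ`. [cite: BakerTNT1975, Ch. 3 §3 Lemma 5] -/
def coeffField : IntermediateField ℚ ℂ := IntermediateField.adjoin ℚ (Set.range (Sum.elim α β))

/-- `αᵢ ∈ K`. [folklore] -/
theorem α_mem_coeffField (i : Fin n) : α i ∈ coeffField α β :=
  IntermediateField.subset_adjoin _ _ ⟨Sum.inl i, rfl⟩

/-- `βⱼ ∈ K`. [folklore] -/
theorem β_mem_coeffField (j : Fin (n + 1)) : β j ∈ coeffField α β :=
  IntermediateField.subset_adjoin _ _ ⟨Sum.inr j, rfl⟩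

variable {α β}
variable (P : Fin n → ℤ[X]) (Q : Fin (n + 1) → ℤ[X]) (hP0 : ∀ i, P i ≠ 0) (hQ0 : ∀ j, Q j ≠ 0)
  (hPd : ∀ i, (P i).natDegree ≤ d) (hQd : ∀ j, (Q j).natDegree ≤ d)
  (hP : ∀ i, aeval (α i) (P i) = 0) (hQ : ∀ j, aeval (β j) (Q j) = 0)

include hP0 hQ0 hP hQ in
/-- **`K` is a number field** (finitely many algebraic generators). [folklore] -/
theorem finiteDimensional_coeffField : FiniteDimensional ℚ (coeffField α β) := by
  unfold coeffField
  haveI : Finite (Set.range (Sum.elim α β)) := Set.finite_range _ |>.to_subtype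
  refine IntermediateField.finiteDimensional_adjoin fun x hx => ?_
  obtain ⟨i, rfl⟩ := hx
  rcases i with i | j
  · refine IsAlgebraic.isIntegral ⟨(P i).map (algebraMap ℤ ℚ), ?_, ?_⟩
    · exact (Polynomial.map_ne_zero_iff (algebraMap ℤ ℚ).injective_int).mpr (hP0 i)
    · simp only [Sum.elim_inl]
      rw [Polynomial.aeval_map_algebraMap]; exact hP i
  · refine IsAlgebraic.isIntegral ⟨(Q j).map (algebraMap ℤ ℚ), ?_, ?_⟩
    · exact (Polynomial.map_ne_zero_iff (algebraMap ℤ ℚ).injective_int).mpr (hQ0 j)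
    · simp only [Sum.elim_inr]
      rw [Polynomial.aeval_map_algebraMap]; exact hQ j

include hP0 hQ0 hPd hQd hP hQ in
/-- **`[K : ℚ] ≤ d^{2n+1}`** (Baker: "degree at most `d^{2n}`" for his count of generators).
[cite: BakerTNT1975, Ch. 3 §3 Lemma 5] -/
theorem finrank_coeffField_le : Module.finrank ℚ (coeffField α β) ≤ d ^ (2 * n + 1) := by
  classical
  have h := finrank_adjoin_le_prod_natDegree (F := ℚ) (E := ℂ) Finset.univ (Sum.elim α β)
    (Sum.elim (fun i => (P i).map (algebraMap ℤ ℚ)) (fun j => (Q j).map (algebraMap ℤ ℚ)))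
    (by
      rintro (i | j) -
      · exact (Polynomial.map_ne_zero_iff (algebraMap ℤ ℚ).injective_int).mpr (hP0 i)
      · exact (Polynomial.map_ne_zero_iff (algebraMap ℤ ℚ).injective_int).mpr (hQ0 j))
    (by
      rintro (i | j) -
      · simp only [Sum.elim_inl]; rw [Polynomial.aeval_map_algebraMap]; exact hP i
      · simp only [Sum.elim_inr]; rw [Polynomial.aeval_map_algebraMap]; exact hQ j)
  rw [Finset.coe_univ, Set.image_univ] at h
  refine h.trans ?_
  calc ∏ i : Fin n ⊕ Fin (n + 1), (Sum.elim (fun i => (P i).map (algebraMap ℤ ℚ))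
        (fun j => (Q j).map (algebraMap ℤ ℚ)) i).natDegree
      ≤ ∏ _i : Fin n ⊕ Fin (n + 1), d := by
        refine Finset.prod_le_prod' fun i _ => ?_
        rcases i with i | j
        · simp only [Sum.elim_inl]
          exact (Polynomial.natDegree_map_le).trans (hPd i)
        · simp only [Sum.elim_inr]
          exact (Polynomial.natDegree_map_le).trans (hQd j)
    _ = d ^ (2 * n + 1) := by
        rw [Finset.prod_const, Finset.card_univ, Fintype.card_sum, Fintype.card_fin, Fintype.card_fin]
        ring_nf

end CoeffField

/-! ### Re-indexing: discard zero logarithms, put a chosen one last -/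

section Reindex

variable {n : ℕ} (l : Fin n → ℂ)

/-- The indices of the non-zero logarithms. [folklore] -/
def nzIdx : Finset (Fin n) := Finset.univ.filter fun i => l i ≠ 0

/-- Membership in `nzIdx`. [folklore] -/
theorem mem_nzIdx {i : Fin n} : i ∈ nzIdx l ↔ l i ≠ 0 := by
  simp [nzIdx]

variable {l}

/-- **The re-indexing** `Fin (n'+1) ≃ {i ; lᵢ ≠ 0}` sending `Fin.last n'` to the chosen index `j`
(Baker, p. 37: "we shall assume that in fact `βₙ ≠ 0`"). [cite: BakerTNT1975, Ch. 3 §4 (p. 37)] -/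
def reidx {n' : ℕ} (hc : (nzIdx l).card = n' + 1) (j : ↥(nzIdx l)) : Fin (n' + 1) ≃ ↥(nzIdx l) :=
  let e : Fin (n' + 1) ≃ ↥(nzIdx l) := (finCongr hc.symm).trans (nzIdx l).equivFin.symm
  (Equiv.swap (e.symm j) (Fin.last n')).trans e

/-- The chosen index is last. [folklore] -/
theorem reidx_last {n' : ℕ} (hc : (nzIdx l).card = n' + 1) (j : ↥(nzIdx l)) :
    reidx hc j (Fin.last n') = j := by
  simp [reidx, Equiv.swap_apply_right]

/-- **Sums over all indices are sums over the re-indexed non-zero logarithms** when the summand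
vanishes at the zero logarithms. [folklore] -/
theorem sum_eq_sum_reidx {n' : ℕ} (hc : (nzIdx l).card = n' + 1) (j : ↥(nzIdx l)) (f : Fin n → ℂ)
    (hf : ∀ i, l i = 0 → f i = 0) : ∑ i, f i = ∑ x : Fin (n' + 1), f (reidx hc j x) := by
  classical
  have h1 : ∑ i, f i = ∑ i ∈ nzIdx l, f i := by
    rw [nzIdx, Finset.sum_filter_of_ne]
    intro i _ hfi hli
    exact hfi (hf i hli)
  have h2 : ∑ i ∈ nzIdx l, f i = ∑ i : ↥(nzIdx l), f i := by
    rw [← Finset.sum_attach]; rfl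
  rw [h1, h2, ← Equiv.sum_comp (reidx hc j) (fun i : ↥(nzIdx l) => f i)]

/-- **The `Setup` attached to the data of Theorem 3.1 and a chosen non-zero logarithm `j`**: the
non-zero logarithms re-indexed with `j` last, and the degree bound `D₀`. [cite: BakerTNT1975, Ch. 3 §3 (p. 32)] -/
def mkSetup (halg : ∀ i, IsAlgebraic ℚ (cexp (l i))) (D₀ : ℕ) {n' : ℕ} (hc : (nzIdx l).card = n' + 1)
    (j : ↥(nzIdx l)) : Setup where
  n := n'
  l x := l (reidx hc j x)
  l_ne_zero x := (mem_nzIdx l).mp (reidx hc j x).2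
  isAlgebraic _ := halg _
  D₀ := D₀

end Reindex

/-! ### The reduction -/

/-- **`|z| ≥ (H+1)⁻¹ > B^{-C}`-type comparison**: for `B ≥ 2` and `C ≥ 2`, `B^{-C} < (B+1)⁻¹`. [folklore] -/
theorem rpow_neg_lt_inv_succ {B : ℕ} (hB : 2 ≤ B) {C : ℝ} (hC : 2 ≤ C) : (B : ℝ) ^ (-C) < ((B : ℝ) + 1)⁻¹ := by
  have hB2 : (2 : ℝ) ≤ B := by exact_mod_cast hB
  have hBpos : (0 : ℝ) < B := by linarith
  calc (B : ℝ) ^ (-C) ≤ (B : ℝ) ^ (-2 : ℝ) := Real.rpow_le_rpow_of_exponent_le (by linarith) (by linarith)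
    _ = ((B : ℝ) ^ 2)⁻¹ := by rw [Real.rpow_neg hBpos.le, Real.rpow_two]
    _ < ((B : ℝ) + 1)⁻¹ := by
        apply inv_strictAnti₀ (by linarith)
        nlinarith

/-- **Reduction of Theorem 3.1 to the normal form** (Baker 1975, p. 37, and §2 p. 29): if for every
`Setup S` there is a constant `Cm S` such that each `D : Data S` with `|Λ'| ≤ e^{-Cm(S)·h}` has
`Λ' = 0`, then `baker1975_thm_3_1` holds. Given `n, d, A, α, l` one discards the zero logarithms;
if all coefficients of the remaining ones vanish, `Λ = β₀` and `|β₀| ≥ (B+1)⁻¹ > B^{-C}` unless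
`β₀ = 0`; otherwise a logarithm `l_j` with `β_j ≠ 0` is put last, the relation is divided by `-β_j`,
the coefficient field `ℚ(α, β)` (degree `≤ d^{2n+1}`) carries the `-βᵢ/β_j` with denominators and
conjugates `≤ (2B)^{5D₀+2} ≤ eʰ`, `h = (5D₀+2)(log₂B+2) ≤ 22(D₀+1) log B`, and `|Λ'| = |Λ|/|β_j| ≤
B^{-C}(B+1) ≤ e^{-Cm h}` for `C = 3 + 22(D₀+1) ∑_j max(Cm S_j, 0)`. [cite: BakerTNT1975, Ch. 3 §4 (p. 37)] -/
theorem baker1975_thm_3_1_of_core (Cm : Setup → ℝ)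
    (core : ∀ (S : Setup) (D : Data S), ‖D.Λ'‖ ≤ Real.exp (-(Cm S * D.h)) → D.Λ' = 0) :
    baker1975_thm_3_1 := by
  intro n d A α l hα0 hexp hαP
  classical
  choose Pα hPα0 hPαdeg hPαH hPαroot using hαP
  have halg : ∀ i, IsAlgebraic ℚ (cexp (l i)) := fun i =>
    ⟨(Pα i).map (algebraMap ℤ ℚ), (Polynomial.map_ne_zero_iff (algebraMap ℤ ℚ).injective_int).mpr (hPα0 i),
      by rw [Polynomial.aeval_map_algebraMap, hexp i]; exact hPαroot i⟩
  set D₀ : ℕ := d ^ (2 * n + 1) with hD₀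
  -- the "trivial" alternative `Λ = β₀`
  have trivial_case : ∀ {C : ℝ}, 2 ≤ C → ∀ B : ℕ, 2 ≤ B → ∀ β : Fin (n + 1) → ℂ,
      (∀ j, ∃ Q : ℤ[X], Q ≠ 0 ∧ Q.natDegree ≤ d ∧ (∀ k, |Q.coeff k| ≤ (B : ℤ)) ∧ aeval (β j) Q = 0) →
      β 0 + ∑ i : Fin n, β i.succ * l i = β 0 →
      (β 0 + ∑ i : Fin n, β i.succ * l i = 0 ∨
        (B : ℝ) ^ (-C) < ‖β 0 + ∑ i : Fin n, β i.succ * l i‖) := by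
    intro C hC B hB β hβ hΛ
    rw [hΛ]
    by_cases hβ0 : β 0 = 0
    · exact Or.inl hβ0
    · right
      obtain ⟨Q, hQ0, -, hQH, hQr⟩ := hβ 0
      have hQH' : ∀ k, |(Q.coeff k : ℝ)| ≤ B := fun k => by exact_mod_cast hQH k
      exact (rpow_neg_lt_inv_succ hB hC).trans_le (inv_norm_le_of_root hQ0 hQH' hβ0 hQr)
  by_cases hI : (nzIdx l).Nonempty
  · obtain ⟨n', hn'⟩ : ∃ n', (nzIdx l).card = n' + 1 := ⟨(nzIdx l).card - 1, by have := hI.card_pos; omega⟩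
    -- the constant
    set Msum : ℝ := ∑ j : ↥(nzIdx l), max (Cm (mkSetup halg D₀ hn' j)) 0 with hMsum
    have hMsum0 : 0 ≤ Msum := Finset.sum_nonneg fun j _ => le_max_right _ _
    set C : ℝ := 3 + 22 * ((D₀ : ℝ) + 1) * Msum with hCdef
    have hC2 : 2 ≤ C := by rw [hCdef]; nlinarith
    refine ⟨C, by linarith, ?_⟩
    intro B hB β hβ
    by_cases hβI : ∀ i ∈ nzIdx l, β i.succ = 0
    · refine trivial_case hC2 B hB β hβ ?_
      rw [add_eq_left]
      refine Finset.sum_eq_zero fun i _ => ?_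
      by_cases hli : l i = 0
      · rw [hli, mul_zero]
      · rw [hβI i ((mem_nzIdx l).mpr hli), zero_mul]
    · push Not at hβI
      obtain ⟨j₀, hj₀, hβj⟩ := hβI
      set j : ↥(nzIdx l) := ⟨j₀, hj₀⟩ with hjdef
      set S : Setup := mkSetup halg D₀ hn' j with hSdef
      choose Qβ hQ0 hQd hQH hQr using hβ
      have hQH' : ∀ t k, |((Qβ t).coeff k : ℝ)| ≤ B := fun t k => by exact_mod_cast hQH t k
      -- the field
      set K := coeffField α β with hKdef
      haveI hfd : FiniteDimensional ℚ K := finiteDimensional_coeffField Pα Qβ hPα0 hQ0 hPαroot hQr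
      have hfin : Module.finrank ℚ K ≤ S.D₀ := finrank_coeffField_le Pα Qβ hPα0 hQ0 hPαdeg hQd hPαroot hQr
      -- the coefficients in `K`
      set bK : Fin (n + 1) → K := fun t => ⟨β t, β_mem_coeffField α β t⟩ with hbK
      have hbKr : ∀ t, aeval (bK t) (Qβ t) = 0 := fun t => (aeval_coe_eq_zero_iff _ _).mp (hQr t)
      have hbKj : bK j₀.succ ≠ 0 := fun h => hβj (by
        have := congrArg (fun x : K => (x : ℂ)) h
        simpa [hbK] using this)
      set tOf : Option (Fin n') → Fin (n + 1) := fun o => o.elim 0 fun r => (reidx hn' j (Fin.castSucc r) : Fin n).succ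
        with htOf
      have hqd := fun o : Option (Fin n') =>
        quotientData (K := K) hfin hB (hQ0 (tOf o)) (hQ0 j₀.succ) (hQH' (tOf o)) (hQH' j₀.succ)
          (hbKr (tOf o)) (hbKr j₀.succ) hbKj
      choose bden hb1 hble hbint hbconj using hqd
      have heh : (2 * B : ℝ) ^ (5 * S.D₀ + 2) ≤ Real.exp (hOf S.D₀ B) := pow_le_exp_hOf _ hB
      -- the `Data`
      set D : Data S :=
        { K := K
          fd := hfd
          finrank_le := hfin
          αmem := fun x => by
            show cexp (l (reidx hn' j x)) ∈ K
            rw [hexp]; exact α_mem_coeffField α β _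
          βv := fun o => -(bK (tOf o)) / bK j₀.succ
          h := hOf S.D₀ B
          two_le_h := two_le_hOf _ _
          bden := bden
          one_le_bden := hb1
          bden_le := fun o => (hble o).trans heh
          isIntegral_bden := hbint
          norm_emb_le := fun φ o => (hbconj o φ).trans heh } with hDdef
      -- `Λ' = -Λ / β_j`
      set Λ : ℂ := β 0 + ∑ i : Fin n, β i.succ * l i with hΛdef
      have hΛ' : D.Λ' = -Λ / β j₀.succ := by
        have hsum := sum_eq_sum_reidx hn' j (fun i => β i.succ * l i) (fun i hi => by rw [hi, mul_zero])
        rw [Fin.sum_univ_castSucc, reidx_last] at hsum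
        have hβ₀v : D.β₀ = -(β 0) / β j₀.succ := rfl
        have hβv : ∀ r : Fin n', D.β r = -(β (reidx hn' j (Fin.castSucc r) : Fin n).succ) / β j₀.succ :=
          fun r => rfl
        have hlcs : ∀ r : Fin n', S.l (Fin.castSucc r) = l (reidx hn' j (Fin.castSucc r)) := fun r => rfl
        have hllast : S.l (Fin.last S.n) = l j₀ := by
          show l (reidx hn' j (Fin.last n')) = l j₀
          rw [reidx_last]
        unfold Data.Λ'
        rw [hβ₀v, hllast]
        simp only [hβv, hlcs]
        set T : ℂ := ∑ r : Fin n', β (reidx hn' j (Fin.castSucc r) : Fin n).succ * l (reidx hn' j (Fin.castSucc r))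
          with hT
        have hS : ∑ r : Fin n', -(β (reidx hn' j (Fin.castSucc r) : Fin n).succ) / β j₀.succ *
            l (reidx hn' j (Fin.castSucc r)) = -T / β j₀.succ := by
          rw [hT, neg_div, Finset.sum_div, ← Finset.sum_neg_distrib]
          exact Finset.sum_congr rfl fun r _ => by ring
        change -β 0 / β j₀.succ + ∑ r : Fin n', -(β (reidx hn' j (Fin.castSucc r) : Fin n).succ) / β j₀.succ *
            l (reidx hn' j (Fin.castSucc r)) - l j₀ = -Λ / β j₀.succ
        rw [hS, hΛdef, hsum]
        change -β 0 / β j₀.succ + -T / β j₀.succ - l j₀ = -(β 0 + (T + β j₀.succ * l j₀)) / β j₀.succ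
        field_simp
        ring
      -- smallness
      by_contra hcon
      push Not at hcon
      obtain ⟨hΛ0, hΛle⟩ := hcon
      have hβjn : ((B : ℝ) + 1)⁻¹ ≤ ‖β j₀.succ‖ := inv_norm_le_of_root (hQ0 _) (hQH' _) hβj (hQr _)
      have hB2 : (2 : ℝ) ≤ B := by exact_mod_cast hB
      have hlogB : 0 < Real.log B := Real.log_pos (by linarith)
      have hsmall : ‖D.Λ'‖ ≤ Real.exp (-(Cm S * D.h)) := by
        have hh : (D.h : ℝ) ≤ 22 * (S.D₀ + 1) * Real.log B := hOf_le _ hB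
        have hM0 : max (Cm S) 0 ≤ Msum := by
          rw [hMsum]
          exact Finset.single_le_sum (f := fun j' : ↥(nzIdx l) => max (Cm (mkSetup halg D₀ hn' j')) 0)
            (fun j' _ => le_max_right _ _) (Finset.mem_univ j)
        -- `‖Λ'‖ ≤ B^{-C} (B+1)`
        have h1 : ‖D.Λ'‖ ≤ (B : ℝ) ^ (-C) * ((B : ℝ) + 1) := by
          rw [hΛ', norm_div, norm_neg]
          have hβpos : 0 < ‖β j₀.succ‖ := norm_pos_iff.mpr hβj
          rw [div_le_iff₀ hβpos]
          calc ‖Λ‖ ≤ (B : ℝ) ^ (-C) := hΛle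
            _ = (B : ℝ) ^ (-C) * (((B : ℝ) + 1) * ((B : ℝ) + 1)⁻¹) := by
                rw [mul_inv_cancel₀ (by linarith), mul_one]
            _ = (B : ℝ) ^ (-C) * ((B : ℝ) + 1) * ((B : ℝ) + 1)⁻¹ := by ring
            _ ≤ (B : ℝ) ^ (-C) * ((B : ℝ) + 1) * ‖β j₀.succ‖ := by gcongr
        -- `B^{-C} (B+1) ≤ B^{2-C} = e^{(2-C) log B} ≤ e^{-Msum·22(D₀+1) log B} ≤ e^{-Cm h}`
        have h2 : (B : ℝ) ^ (-C) * ((B : ℝ) + 1) ≤ Real.exp ((2 - C) * Real.log B) := by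
          have hBpos : (0 : ℝ) < B := by linarith
          rw [Real.rpow_def_of_pos hBpos, show (2 - C) * Real.log B = Real.log B * (-C) + 2 * Real.log B by ring,
            Real.exp_add]
          refine mul_le_mul_of_nonneg_left ?_ (Real.exp_pos _).le
          rw [show (2 : ℝ) * Real.log B = Real.log ((B : ℝ) ^ 2) by rw [Real.log_pow]; norm_num,
            Real.exp_log (by positivity)]
          nlinarith
        have h3 : (2 - C) * Real.log B ≤ -(Cm S * D.h) := by
          have hCm : Cm S * D.h ≤ Msum * (22 * (S.D₀ + 1) * Real.log B) := by
            calc Cm S * D.h ≤ max (Cm S) 0 * D.h :=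
                  mul_le_mul_of_nonneg_right (le_max_left _ _) (Nat.cast_nonneg _)
              _ ≤ Msum * (22 * (S.D₀ + 1) * Real.log B) :=
                  mul_le_mul hM0 hh (Nat.cast_nonneg _) hMsum0
          have hSD : (S.D₀ : ℝ) = D₀ := rfl
          rw [hSD] at hCm
          rw [hCdef]
          nlinarith
        exact h1.trans (h2.trans (Real.exp_le_exp.mpr h3))
      have h0 := core S D hsmall
      rw [hΛ', div_eq_zero_iff, neg_eq_zero] at h0
      rcases h0 with h0 | h0
      · exact hΛ0 h0
      · exact hβj h0
  · -- no non-zero logarithm: `Λ = β₀`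
    refine ⟨2, two_pos, ?_⟩
    intro B hB β hβ
    refine trivial_case le_rfl B hB β hβ ?_
    rw [add_eq_left]
    refine Finset.sum_eq_zero fun i _ => ?_
    have : l i = 0 := by
      by_contra hli
      exact hI ⟨i, (mem_nzIdx l).mpr hli⟩
    rw [this, mul_zero]

end Literature.NumberTheory.Transcendental.Baker1975.Ch3
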